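import Summits.QuantumFields.GaugeBoot.WilsonLoopsGenerateInvariants
import Summits.QuantumFields.GaugeBoot.ZdWilsonLoopsGenerateInvariants
import Summits.QuantumFields.GaugeBoot.PolynomialFunctionalsRealisable
import HarnessLib

/-!
# Wilson loop expectations determine gauge-invariant lattice states (gauge-boot, FFT corollary 3)

HONEST FRAMING (cell `pub-gaugeboot`, page 1 of every file): the venture produces certified bounds
on lattice expectations at stated coupling, gauge group, dimension and torus size; NOT a mass gap,
NOT a continuum limit, NOT a string tension; NOT Yang–Mills-summit-bearing (barriers
`FixedCouplingUltralocality`, `PerturbativeInvisibility`). Structural; no number is certified.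

The lattice analogue of Sengupta's Theorem 4 (Proc. AMS 121 (1994): "the Yang–Mills measure is
determined by the Wilson loop expectation values") and of Durhuus' density statement, obtained
from the lane's first fundamental theorem (`WilsonLoopsGenerateInvariants`,
`ZdWilsonLoopsGenerateInvariants`).

## Content (`SU(N) ⊆ ρ(G) ⊆ U(N)`, `N ≥ 1`)

* ★★ `exists_mem_loopAlgebra_norm_sub_lt` — THE WILSON LOOP ALGEBRA IS DENSE IN THE GAUGE-INVARIANT
  CONTINUOUS OBSERVABLES of the torus (sup norm): polynomials are dense (Stone–Weierstrass, the
  tree's `mem_closure_polyAlgebra`), the gauge average is a contraction fixing the invariant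
  observable, and it maps polynomials into the loop algebra (FFT).
* ★★ `integral_eq_of_forall_mem_loopAlgebra` — two finite measures with the same Wilson-loop-algebra
  expectations give every gauge-invariant continuous observable the same expectation.
* ★★★ `measure_eq_of_gaugeInvariant_of_forall_mem_loopAlgebra` (+ `_suN`, `_uN`) — TWO GAUGE-INVARIANT
  FINITE MEASURES ON THE TORUS CONFIGURATIONS WITH THE SAME EXPECTATIONS ON THE WILSON LOOP ALGEBRA
  ARE EQUAL (polynomial moments determine a finite measure, `eq_of_forall_integral_poly_eq`; an
  invariant measure does not see the gauge average, `integral_avgL_of_map_eq`);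
  ★★★ `measureZd_eq_of_gaugeInvariant_of_forall_mem_loopAlgebraZd` — the same on `ℤ^d` (e.g. for
  gauge-invariant DLR states): a gauge-invariant lattice state IS its Wilson loop data.

References: A. Sengupta, Proc. AMS 121 (1994) 897–905, Thm. 4; B. Durhuus, Lett. Math. Phys. 4
(1980) 515–522.
-/

noncomputable section

namespace Summit.QuantumFields.GaugeBoot

open MeasureTheory
open Literature.MathematicalPhysics.QuantumFieldTheory (Site Edge GaugeConfig LatticeRep gaugeTransform
  IsGaugeInvariant)
open Literature.MathematicalPhysics.QuantumLattice

/-! ## Torus -/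

section Torus

variable {d L : ℕ} [NeZero L] {G : Type*} [Group G] [TopologicalSpace G] [IsTopologicalGroup G]
  [CompactSpace G] [MeasurableSpace G] [BorelSpace G] [SecondCountableTopology G] {r : LatticeRep G}

/-- ★★ **The Wilson loop algebra is dense in the gauge-invariant continuous observables** (sup
norm): every gauge-invariant continuous observable on the torus configurations is within `ε` of a
polynomial in Wilson loops. -/
theorem exists_mem_loopAlgebra_norm_sub_lt (hSU : TensorFFT.ContainsSU r) (hN : 0 < r.N)
    {f : C(GaugeConfig d L G, ℝ)} (hf : IsGaugeInvariant (⇑f)) {ε : ℝ} (hε : 0 < ε) :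
    ∃ g ∈ loopAlgebra (d := d) (L := L) r 0, ‖f - g‖ < ε := by
  obtain ⟨p, hp, hfp⟩ := Metric.mem_closure_iff.1 (mem_closure_polyAlgebra (ι := Edge d L) r f) ε hε
  refine ⟨gaugeAvgL d L G p, gaugeAvgL_mem_loopAlgebra hSU hN hp, ?_⟩
  have e : f - gaugeAvgL d L G p = gaugeAvgL d L G (f - p) := by
    rw [map_sub, gaugeAvgL_of_isGaugeInvariant hf]
  rw [e]
  refine lt_of_le_of_lt (norm_avgL_le _ (f - p)) ?_
  rwa [← dist_eq_norm]

/-- ★★ **Wilson-loop-algebra expectations determine the expectations of all gauge-invariant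
continuous observables**: two finite measures agreeing on `loopAlgebra r 0` agree on every
gauge-invariant continuous observable. -/
theorem integral_eq_of_forall_mem_loopAlgebra (hSU : TensorFFT.ContainsSU r) (hN : 0 < r.N)
    (μ ν : Measure (GaugeConfig d L G)) [IsFiniteMeasure μ] [IsFiniteMeasure ν]
    (h : ∀ g ∈ loopAlgebra (d := d) (L := L) r 0, ∫ U, g U ∂μ = ∫ U, g U ∂ν)
    {f : C(GaugeConfig d L G, ℝ)} (hf : IsGaugeInvariant (⇑f)) : ∫ U, f U ∂μ = ∫ U, f U ∂ν := by
  -- approximate `f` by loop polynomials to any precision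
  refine eq_of_forall_dist_le fun ε hε => ?_
  set M : ℝ := μ.real Set.univ + ν.real Set.univ + 1 with hM
  have hMpos : 0 < M := by rw [hM]; positivity
  obtain ⟨g, hg, hfg⟩ := exists_mem_loopAlgebra_norm_sub_lt hSU hN hf (div_pos hε hMpos)
  have hb : ∀ (ρ' : Measure (GaugeConfig d L G)) [IsFiniteMeasure ρ'],
      |∫ U, f U ∂ρ' - ∫ U, g U ∂ρ'| ≤ ε / M * ρ'.real Set.univ := by
    intro ρ' _
    rw [← integral_sub (f.continuous.integrable_of_hasCompactSupport (HasCompactSupport.of_compactSpace _))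
      (g.continuous.integrable_of_hasCompactSupport (HasCompactSupport.of_compactSpace _))]
    refine (abs_integral_le_integral_abs).trans ?_
    calc ∫ U, |f U - g U| ∂ρ' ≤ ∫ _U, ε / M ∂ρ' := by
          refine integral_mono_of_nonneg (ae_of_all _ fun U => abs_nonneg _) (integrable_const _)
            (ae_of_all _ fun U => ?_)
          change |f U - g U| ≤ ε / M
          have h1 : |f U - g U| = ‖(f - g) U‖ := rfl
          rw [h1]
          exact ((f - g).norm_coe_le_norm U).trans hfg.le
      _ = ε / M * ρ'.real Set.univ := by rw [integral_const, smul_eq_mul, mul_comm]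
  rw [Real.dist_eq]
  calc |∫ U, f U ∂μ - ∫ U, f U ∂ν|
      = |(∫ U, f U ∂μ - ∫ U, g U ∂μ) - (∫ U, f U ∂ν - ∫ U, g U ∂ν)| := by rw [h g hg]; ring_nf
    _ ≤ |∫ U, f U ∂μ - ∫ U, g U ∂μ| + |∫ U, f U ∂ν - ∫ U, g U ∂ν| := abs_sub _ _
    _ ≤ ε / M * μ.real Set.univ + ε / M * ν.real Set.univ := add_le_add (hb μ) (hb ν)
    _ = ε * ((μ.real Set.univ + ν.real Set.univ) / M) := by ring
    _ ≤ ε * 1 := by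
          refine mul_le_mul_of_nonneg_left ?_ hε.le
          rw [div_le_one hMpos, hM]
          linarith
    _ = ε := mul_one ε

/-- ★★★ **GAUGE-INVARIANT LATTICE STATES ARE DETERMINED BY THEIR WILSON LOOP EXPECTATIONS**: two
finite measures on the torus configurations which are invariant under all gauge transformations and
have the same expectations on the Wilson loop algebra at the base point are EQUAL
(`SU(N) ⊆ ρ(G) ⊆ U(N)`, `N ≥ 1`). -/
theorem measure_eq_of_gaugeInvariant_of_forall_mem_loopAlgebra (hSU : TensorFFT.ContainsSU r) (hN : 0 < r.N)
    (μ ν : Measure (GaugeConfig d L G)) [IsFiniteMeasure μ] [IsFiniteMeasure ν]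
    (hμ : ∀ γ : Site d L → G, μ.map (gaugeTransform γ) = μ) (hν : ∀ γ : Site d L → G, ν.map (gaugeTransform γ) = ν)
    (h : ∀ g ∈ loopAlgebra (d := d) (L := L) r 0, ∫ U, g U ∂μ = ∫ U, g U ∂ν) : μ = ν := by
  refine eq_of_forall_integral_poly_eq (ι := Edge d L) r μ ν fun a ha => ?_
  rw [← integral_avgL_of_map_eq gaugeTransform_action.2 a μ hμ,
    ← integral_avgL_of_map_eq gaugeTransform_action.2 a ν hν]
  exact h _ (gaugeAvgL_mem_loopAlgebra hSU hN ha)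

/-- ★★★ `SU(N)`: gauge-invariant finite measures with equal Wilson-loop-algebra expectations are equal. -/
theorem measure_eq_of_gaugeInvariant_of_forall_mem_loopAlgebra_suN (N : ℕ) (hN : 0 < N)
    (μ ν : Measure (GaugeConfig d L (Matrix.specialUnitaryGroup (Fin N) ℂ))) [IsFiniteMeasure μ] [IsFiniteMeasure ν]
    (hμ : ∀ γ : Site d L → Matrix.specialUnitaryGroup (Fin N) ℂ, μ.map (gaugeTransform γ) = μ)
    (hν : ∀ γ : Site d L → Matrix.specialUnitaryGroup (Fin N) ℂ, ν.map (gaugeTransform γ) = ν)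
    (h : ∀ g ∈ loopAlgebra (d := d) (L := L) (fundamentalLatticeRep N) 0, ∫ U, g U ∂μ = ∫ U, g U ∂ν) : μ = ν :=
  measure_eq_of_gaugeInvariant_of_forall_mem_loopAlgebra (containsSU_suN N) hN μ ν hμ hν h

/-- ★★★ `U(N)`: gauge-invariant finite measures with equal Wilson-loop-algebra expectations are equal. -/
theorem measure_eq_of_gaugeInvariant_of_forall_mem_loopAlgebra_uN (N : ℕ) (hN : 0 < N)
    (μ ν : Measure (GaugeConfig d L (Matrix.unitaryGroup (Fin N) ℂ))) [IsFiniteMeasure μ] [IsFiniteMeasure ν]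
    (hμ : ∀ γ : Site d L → Matrix.unitaryGroup (Fin N) ℂ, μ.map (gaugeTransform γ) = μ)
    (hν : ∀ γ : Site d L → Matrix.unitaryGroup (Fin N) ℂ, ν.map (gaugeTransform γ) = ν)
    (h : ∀ g ∈ loopAlgebra (d := d) (L := L) (unitaryFundamentalLatticeRep N) 0, ∫ U, g U ∂μ = ∫ U, g U ∂ν) :
    μ = ν :=
  measure_eq_of_gaugeInvariant_of_forall_mem_loopAlgebra (containsSU_uN N) hN μ ν hμ hν h

end Torus

/-! ## `ℤ^d` -/

section Zd

open Literature.Probability.LatticeModels (Site)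

variable {d : ℕ} {G : Type*} [Group G] [TopologicalSpace G] [IsTopologicalGroup G]
  [CompactSpace G] [MeasurableSpace G] [BorelSpace G] [SecondCountableTopology G] {r : LatticeRep G}

/-- ★★★ **`ℤ^d`: GAUGE-INVARIANT STATES ARE DETERMINED BY THEIR WILSON LOOP EXPECTATIONS** — two
gauge-invariant finite measures on `LGConfig d G` (e.g. gauge-invariant DLR states) with the same
expectations on the Wilson loop algebra of local observables at the origin are equal. -/
theorem measureZd_eq_of_gaugeInvariant_of_forall_mem_loopAlgebraZd (hSU : TensorFFT.ContainsSU r) (hN : 0 < r.N)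
    (μ ν : Measure (LGConfig d G)) [IsFiniteMeasure μ] [IsFiniteMeasure ν]
    (hμ : ∀ γ : Site d → G, μ.map (gaugeTransformZd γ) = μ) (hν : ∀ γ : Site d → G, ν.map (gaugeTransformZd γ) = ν)
    (h : ∀ g ∈ loopAlgebraZd (d := d) r 0, ∫ U, g U ∂μ = ∫ U, g U ∂ν) : μ = ν := by
  refine eq_of_forall_integral_poly_eq (ι := ZdEdge d) r μ ν fun a ha => ?_
  rw [← integral_avgL_of_map_eq gaugeTransformZd_action.2 a μ hμ,
    ← integral_avgL_of_map_eq gaugeTransformZd_action.2 a ν hν]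
  exact h _ (gaugeAvgZdL_mem_loopAlgebraZd hSU hN ha)

/-- ★★★ `SU(N)` on `ℤ^d`: gauge-invariant states with equal Wilson-loop-algebra expectations are equal. -/
theorem measureZd_eq_of_gaugeInvariant_of_forall_mem_loopAlgebraZd_suN (N : ℕ) (hN : 0 < N)
    (μ ν : Measure (LGConfig d (Matrix.specialUnitaryGroup (Fin N) ℂ))) [IsFiniteMeasure μ] [IsFiniteMeasure ν]
    (hμ : ∀ γ : Site d → Matrix.specialUnitaryGroup (Fin N) ℂ, μ.map (gaugeTransformZd γ) = μ)
    (hν : ∀ γ : Site d → Matrix.specialUnitaryGroup (Fin N) ℂ, ν.map (gaugeTransformZd γ) = ν)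
    (h : ∀ g ∈ loopAlgebraZd (d := d) (fundamentalLatticeRep N) 0, ∫ U, g U ∂μ = ∫ U, g U ∂ν) : μ = ν :=
  measureZd_eq_of_gaugeInvariant_of_forall_mem_loopAlgebraZd (containsSU_suN N) hN μ ν hμ hν h

end Zd

end Summit.QuantumFields.GaugeBoot

end
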